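import Summits.AtomisticToContinuum.HydrodynamicLimit.Theses.OneSphereInfluence
import Summits.AtomisticToContinuum.HydrodynamicLimit.Theorems.OneSphereInfluenceAssemblyCore
import HarnessLib

/-!
# Birth skeleton (BC3) of the crux `ResamplingInfluence` — the kick / displacement split

Crux (FIXED, concluded BY NAME below):
`Summit.AtomisticToContinuum.HydrodynamicLimit.Theses.OneSphereInfluence.ResamplingInfluence`
(stmt-AtomisticToContinuum-13618; route `OneSphereInfluence`, rank 3): for the target local Gibbs law
`p_N = localGibbsLaw σ a₁ u₁ θ₁ N (Φ N)`, a pre-shock classical hs-Euler solution matching the data at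
`t = 0`, `t < T` and continuous `χ`,
`Σ_i E_{p_N}[Var_{p_N}(F_t | z_{−i})] → 0` for `F_t = ⟨U_N(t), χ⟩` (density, momentum coordinates,
energy): resampling ONE sphere's initial state `z_i = (q_i, v_i)` from its conditional law moves the
time-`t` macroscopic field by `o(N^{-1/2})` in summed `L²` (the upper Efron–Stein / Glauber sum).

## The split (two registered stubs + a sorry-free composition)

The one-sphere Glauber derivative `D_i F_t = F_t − E[F_t | z_{−i}]` resamples a POSITION and a
VELOCITY at once. Insert the intermediate σ-algebra `σ(z_{−i}, q_i)` ("everything but the velocity of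
sphere `i`"): `σ(z_{−i}) ≤ σ(z_{−i}) ⊔ σ(q_i) ≤ ambient`. The CONDITIONAL LAW OF TOTAL VARIANCE along
this two-step filtration is the exact identity (for `F ∈ L²(p)`, `p` a probability measure)

  `E Var(F | z_{−i}) = E Var(F | z_{−i}, q_i) + E Var( E[F | z_{−i}, q_i] | z_{−i} )`

(proved below, `integral_condVar_eq_add_of_le`, from Mathlib's law of total variance
`integral_condVar_add_variance_condExp` applied three times and the tower property). Summed over `i`
it splits the crux's functional, observable by observable, into two non-negative channels:

* `stub_velocityKick : Stubs.stub_velocityKick` — VELOCITY-KICK INFLUENCE, THE KICK CHANNEL (hardest). Under the local Gibbs law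
  the velocity `v_i` is, conditionally on all positions and the other velocities, EXACTLY the local
  Maxwellian `M_{u₁(q_i), θ₁(q_i)}` and independent of everything else (`localGibbsProfile`); the stub
  says that re-drawing ONE velocity (an `O(1)` momentum/energy kick to a tagged sphere at rest of the
  data) moves the time-`t` macroscopic field by `o(N^{-1/2})` in summed `L²`:
  `Σ_i E Var(F_t | z_{−i}, q_i) → 0`. This is the Lyapunov-cascade question of the crux in its purest
  form — the injected momentum and energy are conserved and can reach the macroscopic field only
  through the hydrodynamic (sound / shear / heat) response to a tagged-particle kick
  (Alder–Wainwright); the bet of the route is that the cascade re-randomises only the fast,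
  Euler-invisible part of the data. Why it might fail: exactly the crux's failure mode (one kick
  re-randomises the whole `O(N^{-1/2})` fluctuation field), now isolated from the static dressing.
* `stub_positionRelocation : Stubs.stub_positionRelocation` — POSITION-RELOCATION INFLUENCE, THE
  DISPLACEMENT CHANNEL. Relocating ONE sphere inside its cavity (conditional law
  `∝ a₁(q) 𝟙{no overlap with z_{−i}} dq`) AFTER its velocity has been averaged out moves the
  kick-averaged field `E[F_t | z_{−i}, q_i]` by `o(N^{-1/2})` in summed `L²`:
  `Σ_i E Var(E[F_t | z_{−i}, q_i] | z_{−i}) → 0` — a mass-displacement (density / sound) imprint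
  of one sphere, of static size `O(1/N)` dressed by the hard-core pair correlation at packing `∝ σ³`.
  Why it might fail: the velocity average does not remove the position sensitivity of a chaotic flow;
  only the macroscopic averaging does, which is again the crux's bet (but for a scalar, zero-momentum
  perturbation).
* `ResamplingInfluence_of (hK : Stubs.stub_velocityKick) (hR : Stubs.stub_positionRelocation) :
  ResamplingInfluence` — the ONLY theorem concluding the crux by name; sorry-free: `σ₀ := min σ₀ᴷ σ₀ᴿ (1/2)`;
  the local Gibbs laws are probability measures for `σ ≤ 1/2` (`isProbabilityMeasure_localGibbsLaw`);
  the time-`t` empirical density / momentum / energy fields are in `L²(p_N)` (energy domination on the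
  good set of the flow by conservation of kinetic energy + Gaussian fourth moments: the PROVED assembly lemmas `memLp_two_of_abs_le_energy`,
  `abs_empirical{Density,Momentum,Energy}Field_flow(_apply)_le`, `ae_mem_good_localGibbsMeasure` of
  `Theorems/OneSphereInfluenceAssembly{Core,Moments}.lean`); then the conditional law of total
  variance term by term and `lim (a_N + b_N) = 0 + 0`.

Both stubs are CONSEQUENCES of the crux (conditioning on more, or taking the conditional variance of
a conditional mean, only lowers `E Var`) and are JOINTLY equivalent to it: an exact orthogonal
decomposition of the Efron–Stein sum into the velocity and the position degrees of freedom of the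
resampled sphere, not a weakening and not a restatement (each stub forgets one channel; neither
implies the crux or the summit conjunct — BC3 probes in `bc/`). No stub is a refuted statement
(`ledger negatives`: none on this crux); the crux carries no Disproof.lean yet.

Sources: EfronStein1981 (the jackknife / ANOVA decomposition), Chatterjee2016 (Glauber calculus),
Duerinckx2021 = arXiv:1912.01366 Prop. 1 (mean-field analogue), Spohn1991 Part II §7.1,
AlderWainwright1970 (kick response / long-time tails).

planner-skel-stmt-AtomisticToContinuum-13618-0 (skeleton-register, route re-audit bin REPAIRABLE),
2026-08-17.
-/

noncomputable section

open MeasureTheory ProbabilityTheory Filter Set Topology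
open scoped ENNReal

namespace Summit.AtomisticToContinuum.HydrodynamicLimit.Cruxes.ResamplingInfluence.Birth

open Literature.Analysis.FluidPDE Literature.MathematicalPhysics.KineticTheory
open Summit.AtomisticToContinuum.HydrodynamicLimit.Theses.OneSphereInfluence (ResamplingInfluence)
open Summit.AtomisticToContinuum.HydrodynamicLimit.Theorems.OneSphereInfluenceAssembly

/-! ## The two stub statements as named `Prop`s (D-0027 §3.3 shape)

`ResamplingInfluence_of` takes exactly the two propositions `Stubs.stub_*` BY NAME (the declared stubs of this
Line; the `@[stub]` tag itself is gate-reserved, so admissibility in the skeleton audit is by the short name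
`stub_*`); the registered stubs `stub_*` below assert them and are the ONLY declarations of this file that use
`sorry`; the final `example` checks `ResamplingInfluence_of stub_velocityKick stub_positionRelocation :
ResamplingInfluence`. -/

namespace Stubs

/-- **VELOCITY-KICK INFLUENCE** (stub 1, the hardest). Same hypotheses as the crux; conclusion with the
FINER σ-algebra `σ(z_{−i}) ⊔ σ(q_i)` (all spheres but `i`, and the position of sphere `i`): re-drawing
ONE velocity from its local Maxwellian moves the time-`t` empirical density / momentum / energy field
by `o(N^{-1/2})` in summed `L²`, `Σ_i E_p[Var_p(F_t | z_{−i}, q_i)] → 0`. (Registered stub: the theorem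
`stub_velocityKick` below.) -/
def stub_velocityKick : Prop :=
  ∀ (a₁ θ₁ : T3 → ℝ) (u₁ : T3 → V3), Continuous a₁ → Continuous θ₁ → Continuous u₁ →
    (∀ x, 0 < a₁ x) → (∀ x, 0 < θ₁ x) →
    ∃ σ₀ : ℝ, 0 < σ₀ ∧ ∀ σ : ℝ, 0 < σ → σ < σ₀ →
      ∀ (T : ℝ) (ρ θ : ℝ → T3 → ℝ) (u : ℝ → T3 → V3), IsHardSphereEulerSolution σ T ρ u θ →
        ∀ Φ : (N : ℕ) → HardSphereFlow (Torus.geometry (Fin 3)) (hsDiameter σ N) (N + 1),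
          TendstoHydroFieldsAt (fun N => localGibbsLaw σ a₁ u₁ θ₁ N (Φ N)) Φ ρ u θ 0 →
            ∀ t ∈ Ico 0 T, ∀ χ : T3 → ℝ, Continuous χ →
              let p : (N : ℕ) → Measure (Config (N + 1) (Fin 3) T3) :=
                fun N => localGibbsLaw σ a₁ u₁ θ₁ N (Φ N)
              let mq : (N : ℕ) → Fin (N + 1) → MeasurableSpace (Config (N + 1) (Fin 3) T3) :=
                fun N i =>
                  MeasurableSpace.comap (fun (z : Config (N + 1) (Fin 3) T3) (j : Fin N) => z (i.succAbove j))
                      MeasurableSpace.pi ⊔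
                    MeasurableSpace.comap (fun z : Config (N + 1) (Fin 3) T3 => (z i).1) MeasurableSpace.pi
              Tendsto (fun N : ℕ => ∑ i : Fin (N + 1), ∫ z, condVar (mq N i)
                  (fun z => empiricalDensityField ((Φ N).flow t z) χ) (p N) z ∂(p N)) atTop (𝓝 0) ∧
              (∀ j : Fin 3, Tendsto (fun N : ℕ => ∑ i : Fin (N + 1), ∫ z, condVar (mq N i)
                  (fun z => empiricalMomentumField ((Φ N).flow t z) χ j) (p N) z ∂(p N)) atTop (𝓝 0)) ∧
              Tendsto (fun N : ℕ => ∑ i : Fin (N + 1), ∫ z, condVar (mq N i)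
                  (fun z => empiricalEnergyField ((Φ N).flow t z) χ) (p N) z ∂(p N)) atTop (𝓝 0)

/-- **POSITION-RELOCATION INFLUENCE** (stub 2). Same hypotheses as the crux; conclusion: the
conditional variance, given all spheres but `i`, of the KICK-AVERAGED field `E_p[F_t | z_{−i}, q_i]`
(a function of `z_{−i}` and the position `q_i` only) is `o(N^{-1/2})` in summed `L²`:
`Σ_i E_p[Var_p(E_p[F_t | z_{−i}, q_i] | z_{−i})] → 0` — relocating one sphere inside its cavity. (Registered
stub: the theorem `stub_positionRelocation` below.) -/
def stub_positionRelocation : Prop :=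
  ∀ (a₁ θ₁ : T3 → ℝ) (u₁ : T3 → V3), Continuous a₁ → Continuous θ₁ → Continuous u₁ →
    (∀ x, 0 < a₁ x) → (∀ x, 0 < θ₁ x) →
    ∃ σ₀ : ℝ, 0 < σ₀ ∧ ∀ σ : ℝ, 0 < σ → σ < σ₀ →
      ∀ (T : ℝ) (ρ θ : ℝ → T3 → ℝ) (u : ℝ → T3 → V3), IsHardSphereEulerSolution σ T ρ u θ →
        ∀ Φ : (N : ℕ) → HardSphereFlow (Torus.geometry (Fin 3)) (hsDiameter σ N) (N + 1),
          TendstoHydroFieldsAt (fun N => localGibbsLaw σ a₁ u₁ θ₁ N (Φ N)) Φ ρ u θ 0 →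
            ∀ t ∈ Ico 0 T, ∀ χ : T3 → ℝ, Continuous χ →
              let p : (N : ℕ) → Measure (Config (N + 1) (Fin 3) T3) :=
                fun N => localGibbsLaw σ a₁ u₁ θ₁ N (Φ N)
              let m : (N : ℕ) → Fin (N + 1) → MeasurableSpace (Config (N + 1) (Fin 3) T3) :=
                fun N i =>
                  MeasurableSpace.comap (fun (z : Config (N + 1) (Fin 3) T3) (j : Fin N) => z (i.succAbove j))
                    MeasurableSpace.pi
              let mq : (N : ℕ) → Fin (N + 1) → MeasurableSpace (Config (N + 1) (Fin 3) T3) :=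
                fun N i =>
                  MeasurableSpace.comap (fun (z : Config (N + 1) (Fin 3) T3) (j : Fin N) => z (i.succAbove j))
                      MeasurableSpace.pi ⊔
                    MeasurableSpace.comap (fun z : Config (N + 1) (Fin 3) T3 => (z i).1) MeasurableSpace.pi
              Tendsto (fun N : ℕ => ∑ i : Fin (N + 1), ∫ z, condVar (m N i)
                  (condExp (mq N i) (p N) (fun z => empiricalDensityField ((Φ N).flow t z) χ))
                  (p N) z ∂(p N)) atTop (𝓝 0) ∧
              (∀ j : Fin 3, Tendsto (fun N : ℕ => ∑ i : Fin (N + 1), ∫ z, condVar (m N i)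
                  (condExp (mq N i) (p N) (fun z => empiricalMomentumField ((Φ N).flow t z) χ j))
                  (p N) z ∂(p N)) atTop (𝓝 0)) ∧
              Tendsto (fun N : ℕ => ∑ i : Fin (N + 1), ∫ z, condVar (m N i)
                  (condExp (mq N i) (p N) (fun z => empiricalEnergyField ((Φ N).flow t z) χ))
                  (p N) z ∂(p N)) atTop (𝓝 0)

end Stubs

/-! ## The registered stubs (the ONLY sorries of the file) -/

/-- Stub 1 (hardest) — VELOCITY-KICK INFLUENCE: the velocity-kick channel of the one-sphere influence
vanishes, `Σ_i E_p[Var_p(F_t | z_{−i}, q_i)] → 0`. -/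
theorem stub_velocityKick : Stubs.stub_velocityKick := by
  sorry

/-- Stub 2 — POSITION-RELOCATION INFLUENCE: the position-relocation channel of the one-sphere influence
vanishes, `Σ_i E_p[Var_p(E_p[F_t | z_{−i}, q_i] | z_{−i})] → 0`. -/
theorem stub_positionRelocation : Stubs.stub_positionRelocation := by
  sorry

/-! ## The conditional law of total variance (sorry-free glue) -/

/-- **Conditional law of total variance along a two-step filtration** `m ≤ m' ≤ m₀`: for
`X ∈ L²(μ)`, `μ` a probability measure,
`E Var(X | m) = E Var(X | m') + E Var(E[X | m'] | m)`.
From Mathlib's law of total variance (`integral_condVar_add_variance_condExp`) for `(X, m)`,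
`(X, m')` and `(E[X | m'], m)`, and the tower property `E[E[X | m'] | m] = E[X | m]`. [folklore] -/
theorem integral_condVar_eq_add_of_le {Ω : Type*} {m m' m₀ : MeasurableSpace Ω} {μ : Measure[m₀] Ω}
    [IsProbabilityMeasure μ] (hm : m ≤ m') (hm' : m' ≤ m₀) {X : Ω → ℝ} (hX : MemLp X 2 μ) :
    μ[Var[X; μ | m]] = μ[Var[X; μ | m']] + μ[Var[μ[X | m']; μ | m]] := by
  have hmm₀ : m ≤ m₀ := hm.trans hm'
  have hY : MemLp (μ[X | m']) 2 μ := hX.condExp one_le_two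
  have h1 := integral_condVar_add_variance_condExp hmm₀ hX
  have h2 := integral_condVar_add_variance_condExp hm' hX
  have h3 := integral_condVar_add_variance_condExp hmm₀ hY
  have htower : μ[μ[X | m'] | m] =ᵐ[μ] μ[X | m] := condExp_condExp_of_le hm hm'
  rw [variance_congr htower] at h3
  linarith

/-! ## The σ-algebras of the split on `(N+1)`-sphere phase space -/

/-- `σ(z_{−i})`: the configuration with sphere `i` deleted (the crux's `m N i`). -/
abbrev restSigma (N : ℕ) (i : Fin (N + 1)) : MeasurableSpace (Config (N + 1) (Fin 3) T3) :=
  MeasurableSpace.comap (fun (z : Config (N + 1) (Fin 3) T3) (j : Fin N) => z (i.succAbove j))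
    MeasurableSpace.pi

/-- `σ(z_{−i}, q_i) = σ(z_{−i}) ⊔ σ(q_i)`: everything but the velocity of sphere `i`. -/
abbrev restPosSigma (N : ℕ) (i : Fin (N + 1)) : MeasurableSpace (Config (N + 1) (Fin 3) T3) :=
  restSigma N i ⊔ MeasurableSpace.comap (fun z : Config (N + 1) (Fin 3) T3 => (z i).1) MeasurableSpace.pi

theorem restSigma_le_restPosSigma (N : ℕ) (i : Fin (N + 1)) : restSigma N i ≤ restPosSigma N i :=
  le_sup_left

theorem restPosSigma_le (N : ℕ) (i : Fin (N + 1)) :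
    restPosSigma N i ≤ (MeasurableSpace.pi : MeasurableSpace (Config (N + 1) (Fin 3) T3)) :=
  sup_le (Measurable.comap_le (measurable_pi_lambda _ fun _ => measurable_pi_apply _))
    (Measurable.comap_le (measurable_pi_apply i).fst)

/-- **The split, at fixed `N`**: for an `L²` observable `G` under a probability law `p` on
`(N+1)`-sphere phase space, the Efron–Stein sum splits into the kick and the relocation channels,
`Σ_i E Var(G | z_{−i}) = Σ_i E Var(G | z_{−i}, q_i) + Σ_i E Var(E[G | z_{−i}, q_i] | z_{−i})`.
[folklore] -/
theorem sum_integral_condVar_split {N : ℕ} (p : Measure (Config (N + 1) (Fin 3) T3))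
    [IsProbabilityMeasure p] {G : Config (N + 1) (Fin 3) T3 → ℝ} (hG : MemLp G 2 p) :
    ∑ i : Fin (N + 1), ∫ z, condVar (restSigma N i) G p z ∂p =
      ∑ i : Fin (N + 1), ∫ z, condVar (restPosSigma N i) G p z ∂p +
        ∑ i : Fin (N + 1), ∫ z, condVar (restSigma N i) (condExp (restPosSigma N i) p G) p z ∂p := by
  rw [← Finset.sum_add_distrib]
  exact Finset.sum_congr rfl fun i _ =>
    integral_condVar_eq_add_of_le (restSigma_le_restPosSigma N i) (restPosSigma_le N i) hG

/-! ## The composition: the two stubs imply the crux BY NAME -/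

/-- **Birth certificate of `ResamplingInfluence`**: the velocity-kick influence and the
position-relocation influence statements imply the crux (the route decl, by name). Sorry-free:
probability of the local Gibbs laws (`σ ≤ 1/2`), `L²`-membership of the time-`t` empirical fields
(conservation of kinetic energy on the good set + Gaussian moments), the conditional law of total
variance at each `N`, and the sum of the two limits. -/
theorem ResamplingInfluence_of (hK : Stubs.stub_velocityKick) (hR : Stubs.stub_positionRelocation) :
    ResamplingInfluence := by
  intro a₁ θ₁ u₁ ha₁ hθ₁ hu₁ ha₁0 hθ₁0
  obtain ⟨σK, hσK, hKσ⟩ := hK a₁ θ₁ u₁ ha₁ hθ₁ hu₁ ha₁0 hθ₁0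
  obtain ⟨σR, hσR, hRσ⟩ := hR a₁ θ₁ u₁ ha₁ hθ₁ hu₁ ha₁0 hθ₁0
  refine ⟨min (min σK σR) (1 / 2), lt_min (lt_min hσK hσR) one_half_pos, ?_⟩
  intro σ hσ hσlt T ρ θ u hsol Φ hinit t ht χ hχ
  have hσK' : σ < σK := lt_of_lt_of_le hσlt ((min_le_left _ _).trans (min_le_left _ _))
  have hσR' : σ < σR := lt_of_lt_of_le hσlt ((min_le_left _ _).trans (min_le_right _ _))
  have hσ2 : σ ≤ 1 / 2 := (lt_of_lt_of_le hσlt (min_le_right _ _)).le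
  have hKt := hKσ σ hσ hσK' T ρ θ u hsol Φ hinit t ht χ hχ
  have hRt := hRσ σ hσ hσR' T ρ θ u hsol Φ hinit t ht χ hχ
  dsimp only at hKt hRt ⊢
  obtain ⟨hKd, hKm, hKe⟩ := hKt
  obtain ⟨hRd, hRm, hRe⟩ := hRt
  -- the local Gibbs laws are probability measures (`σ ≤ 1/2`)
  have hprob : ∀ N, IsProbabilityMeasure (localGibbsLaw σ a₁ u₁ θ₁ N (Φ N)) := fun N =>
    isProbabilityMeasure_localGibbsLaw ha₁ hθ₁ hu₁ ha₁0 hθ₁0 hσ2 N (Φ N)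
  -- bounds on the test function and on the profiles
  obtain ⟨Cχ, hCχ0, hCχ⟩ := exists_forall_abs_le_of_continuous hχ
  obtain ⟨U, hU⟩ := isCompact_univ.exists_bound_of_continuousOn hu₁.continuousOn
  obtain ⟨Θ, -, hΘ⟩ := exists_forall_abs_le_of_continuous hθ₁
  have hU' : ∀ x, ‖u₁ x‖ ≤ U := fun x => hU x (mem_univ x)
  have hΘ' : ∀ x, θ₁ x ≤ Θ := fun x => (le_abs_self _).trans (hΘ x)
  -- energy-dominated time-`t` observables are in `L²(p_N)`
  have hmem : ∀ (N : ℕ) (G : Config (N + 1) (Fin 3) T3 → ℝ), Measurable G →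
      (∀ z ∈ (Φ N).good, |G z| ≤ Cχ * (1 + ((N + 1 : ℕ) : ℝ)⁻¹ * ∑ i, ‖(z i).2‖ ^ 2)) →
      MemLp G 2 (localGibbsLaw σ a₁ u₁ θ₁ N (Φ N)) := by
    intro N G hGm hGb
    rw [localGibbsLaw_eq]
    haveI : IsProbabilityMeasure (localGibbsMeasure σ a₁ u₁ θ₁ N) :=
      isProbabilityMeasure_localGibbsMeasure ha₁ hθ₁ hu₁ ha₁0 hθ₁0 hσ2 N
    refine (memLp_two_of_abs_le_energy ha₁ hθ₁ hu₁ (fun x => (ha₁0 x).le) hθ₁0 hU' hΘ' σ N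
      hGm.aestronglyMeasurable hCχ0 ?_).1
    filter_upwards [ae_mem_good_localGibbsMeasure σ a₁ u₁ θ₁ N (Φ N)] with z hz
    exact hGb z hz
  -- the split for an `N`-indexed family of such observables
  have split : ∀ F : (N : ℕ) → Config (N + 1) (Fin 3) T3 → ℝ, (∀ N, Measurable (F N)) →
      (∀ N, ∀ z ∈ (Φ N).good, |F N z| ≤ Cχ * (1 + ((N + 1 : ℕ) : ℝ)⁻¹ * ∑ i, ‖(z i).2‖ ^ 2)) →
      Tendsto (fun N : ℕ => ∑ i : Fin (N + 1), ∫ z, condVar (restPosSigma N i) (F N)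
        (localGibbsLaw σ a₁ u₁ θ₁ N (Φ N)) z ∂(localGibbsLaw σ a₁ u₁ θ₁ N (Φ N))) atTop (𝓝 0) →
      Tendsto (fun N : ℕ => ∑ i : Fin (N + 1), ∫ z, condVar (restSigma N i)
        (condExp (restPosSigma N i) (localGibbsLaw σ a₁ u₁ θ₁ N (Φ N)) (F N))
        (localGibbsLaw σ a₁ u₁ θ₁ N (Φ N)) z ∂(localGibbsLaw σ a₁ u₁ θ₁ N (Φ N))) atTop (𝓝 0) →
      Tendsto (fun N : ℕ => ∑ i : Fin (N + 1), ∫ z, condVar (restSigma N i) (F N)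
        (localGibbsLaw σ a₁ u₁ θ₁ N (Φ N)) z ∂(localGibbsLaw σ a₁ u₁ θ₁ N (Φ N))) atTop (𝓝 0) := by
    intro F hFm hFb hk hr
    have heq : ∀ N : ℕ, ∑ i : Fin (N + 1), ∫ z, condVar (restSigma N i) (F N)
        (localGibbsLaw σ a₁ u₁ θ₁ N (Φ N)) z ∂(localGibbsLaw σ a₁ u₁ θ₁ N (Φ N)) =
        ∑ i : Fin (N + 1), ∫ z, condVar (restPosSigma N i) (F N)
          (localGibbsLaw σ a₁ u₁ θ₁ N (Φ N)) z ∂(localGibbsLaw σ a₁ u₁ θ₁ N (Φ N)) +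
        ∑ i : Fin (N + 1), ∫ z, condVar (restSigma N i)
          (condExp (restPosSigma N i) (localGibbsLaw σ a₁ u₁ θ₁ N (Φ N)) (F N))
          (localGibbsLaw σ a₁ u₁ θ₁ N (Φ N)) z ∂(localGibbsLaw σ a₁ u₁ θ₁ N (Φ N)) := by
      intro N
      haveI := hprob N
      exact sum_integral_condVar_split _ (hmem N (F N) (hFm N) (hFb N))
    rw [show (fun N : ℕ => ∑ i : Fin (N + 1), ∫ z, condVar (restSigma N i) (F N)
        (localGibbsLaw σ a₁ u₁ θ₁ N (Φ N)) z ∂(localGibbsLaw σ a₁ u₁ θ₁ N (Φ N))) = fun N : ℕ =>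
        ∑ i : Fin (N + 1), ∫ z, condVar (restPosSigma N i) (F N)
          (localGibbsLaw σ a₁ u₁ θ₁ N (Φ N)) z ∂(localGibbsLaw σ a₁ u₁ θ₁ N (Φ N)) +
        ∑ i : Fin (N + 1), ∫ z, condVar (restSigma N i)
          (condExp (restPosSigma N i) (localGibbsLaw σ a₁ u₁ θ₁ N (Φ N)) (F N))
          (localGibbsLaw σ a₁ u₁ θ₁ N (Φ N)) z ∂(localGibbsLaw σ a₁ u₁ θ₁ N (Φ N)) from funext heq]
    simpa using hk.add hr
  refine ⟨?_, fun j => ?_, ?_⟩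
  · exact split (fun N z => empiricalDensityField ((Φ N).flow t z) χ)
      (fun N => (continuous_empiricalDensityField hχ).measurable.comp ((Φ N).measurable_flow t))
      (fun N z hz => abs_empiricalDensityField_flow_le (Φ N) hCχ t hz) hKd hRd
  · exact split (fun N z => empiricalMomentumField ((Φ N).flow t z) χ j)
      (fun N => ((continuous_apply j).comp ((PiLp.continuous_ofLp 2 _).comp
        (continuous_empiricalMomentumField hχ))).measurable.comp ((Φ N).measurable_flow t))
      (fun N z hz => abs_empiricalMomentumField_flow_apply_le (Φ N) hCχ t j hz) (hKm j) (hRm j)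
  · exact split (fun N z => empiricalEnergyField ((Φ N).flow t z) χ)
      (fun N => (continuous_empiricalEnergyField hχ).measurable.comp ((Φ N).measurable_flow t))
      (fun N z hz => abs_empiricalEnergyField_flow_le (Φ N) hCχ t hz) hKe hRe

/-- The two spellings agree: the crux from the two registered (sorried) stubs. -/
example : ResamplingInfluence :=
  ResamplingInfluence_of stub_velocityKick stub_positionRelocation

end Summit.AtomisticToContinuum.HydrodynamicLimit.Cruxes.ResamplingInfluence.Birth

end
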